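import Summits.QuantumFields.YangMills.Theorems.BalabanUVNodesN13Cor3AEKeepZeroOfEnginesRowAtRecord13Chi
import Literature.MathematicalPhysics.QuantumFieldTheory.Balaban1983to89.B16NodeKnitRecord13CoPH

/-!
# BalabanUVNodes ∕ N13 → K1ᴬ LINE 2′ — THEOREM-1-FREE: the ENGINES' N13 ROW (level 0 at every field, levels ≥ 1 `dV`-a.e., `SLaw`-GUARDED) ⟹ AN A.E.-REVISION `v` OF THE RE-CENTRED RECORD
# CARRYING THE `SLaw`-GUARDED POINTWISE (2.50) ROW ON `v.ρ` — exactly what N13's node `Dag.B16_main` at a REVISED-record world consumes (rung 1ⱽᵂ of K1ᴬ v11.1, stmt-QuantumFields-27239)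

TRACK A (YM-PLAN §2d), seat `pub-ymgap-dag-n24-c` g24 (K1ᴬ LINE 2′ -a hand; N13-side glue typed from the K1ᴬ lane — yields to any dag-n13 seat on «MINE»), `--kind proof --supports
stmt-QuantumFields-27239 --as helper`, count-neutral.  Sequel of this seat's (G) `…N13Cor3AEKeepZeroOfEnginesRowAtRecord13Chi` ✓p810331, whose every theorem asks `B16.Thm1Printed` to pay the
`SLaw` guard and conclude the UNGUARDED `B16.EndStatementBPrinted`; rung 1ⱽᵂ needs neither: N13's node reads (2.50) only BEHIND the §2-description guard (`Dag.B16_main`'s `uvBounds` conclusion is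
asked under `densitiesDescribed`; n13-a `uvSlot_at_construction`'s `hUV9` is `Laws`-guarded), so the engines' row transfers to the revision WITH ITS GUARD and WITHOUT Theorem 1.

WHAT IS HERE (theorems only; 0 `def`, 0 `sorry`, standard axioms):
* §1 (generic, any core `M`, any guard `Gd : RunParams → ℕ → Prop`) ★ `exists_rho_keep0_ae_eq_guardedUV_construction_of_ae` — `χ ≤ 1`, `0 ≤ A^η`, the two-sided bound (2.50) with `em, ep`
  on the window at level 0 at EVERY field under `Gd p 0` and at each level `k+1 ≤ K` for `dV`-a.e. field under `Gd p (k+1)` ⟹ densities `ρ′` with `ρ′ p 0 = ρ p 0`, `ρ′ p k =ᵐ[dV] ρ p k` and the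
  GUARDED bound «window ⇒ `k ≤ K` ⇒ `Gd p k` ⇒ ∀ V, (2.50) at `{M.construction ρ p with ρ := ρ′ p}` with `em`, `max ep (−em)`» (re-choose the upper barrier on the guarded exceptional null sets;
  the parent's `exists_rho_keep0_ae_eq_endStatementBPrinted_construction_of_thm1_of_ae` minus Theorem 1, plus the guard).
* §2 ★★ `exists_revision₁₃Chi_guardedUVRowV_of_row0_of_aeRowSucc` (χ-generic record, `hχ1 : χ ≤ 1`) and ★★★ `exists_revision₁₃Ax_guardedUVRowV_of_row0_of_aeRowSucc` (the RE-CENTRED instance,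
  `chiβOfRecord₁₃Ax ≤ 1` by (G)): the K1ᴬ ENGINE's N13 binder `h13` VERBATIM (✓p811182 §2 ∕ ✓p810415 §2Ax shape) ⟹ `∃ v : Revision₁₃Ax F N θ h`, the `SLaw₁₃CoPHChi`-GUARDED pointwise row on `v.ρ`
  in the record's letters with `em`, `max ep (−em)` on the window `γ` — THE N13 BILL OF RUNG 1ⱽᵂ in its guarded currency.
* §3 ★★ `b16_main_at_recordVAx_of_rOperation_of_guardedUVRowV` — N13's node `Dag.B16_main (leavesP w P)` at ANY world bound to `datumOfRecord₁₃SepCoPHVAx θ h v` whose `up P` carries the 𝐑-leaf,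
  from the GUARDED row with the world's letters (`w.γ ≤ γ₁₃`, `w.em`, `w.ep`) — binding-agnostic (n13-a `uvSlot_at_construction` at the χ-generic core; this seat's (Q) §1 is its Cor-3 corollary).

HONEST SCOPE ∕ A6.  Bookkeeping (measure-zero re-choice + structure η); the engines' row is a DISPLAYED hypothesis, inhabited at NO θ here; nothing of Bałaban asserted; N13 NOT discharged; no stub of
K1ᴬ closed; K1ᴬ OPEN (v11.1 0∕6); counts UNMOVED (discharged 8∕27 · K 1∕4).  One finite 𝕋⁴ programme at fixed ε — NOT continuum ∕ ℝ⁴ ∕ OS; NOT the Yang–Mills mass gap (Clay).  No `def`, no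
`instance`, no `sorry`.  References (bookkeeping only): [Balaban1989LargeFieldII] Thm 1 p.355, (0.1) pp.355–356, p.387, p.391; [Balaban1988Convergent] (0.2) p.244, (2.18) p.257, Cor. 3 (2.50) p.264;
[Balaban1987RG1] (2.9) p.266 with (2.3) p.265, (0.17)–(0.20) pp.255–256; [Balaban1989LargeFieldI] (0.2)–(0.4) p.176.
-/

noncomputable section

open scoped ENNReal BigOperators

namespace Summit.QuantumFields.YangMills.BalabanUVNodes.N13GuardedUVRowAtRevisionOfAERowsAtRecord13Ax

open MeasureTheory Set
open Literature.MathematicalPhysics.QuantumFieldTheory.Balaban1983to89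
open Literature.MathematicalPhysics.QuantumFieldTheory.Balaban1983to89.T4Continuum (T4Family)
open Literature.MathematicalPhysics.QuantumFieldTheory.Balaban1983to89.Node00
open DagBinding T4DatumAssembly FlowStepRuns
open Summit.QuantumFields.YangMills.BalabanUVNodes.N13Cor3AEIffUpToVersionAtRecord13 (uvIneq_barrier_le uvIneq_mono_ep)
open Summit.QuantumFields.YangMills.BalabanUVNodes.N13Cor3AEKeepZeroOfEnginesRowAtRecord13Chi (signs_datum_chi uvIneq_at_record₁₃SepCoPH_iff_chi chiβOfRecord₁₃Ax_le_one)
open B16NodeKnitRepTowerOfRecord (uvSlot_at_construction)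
open B16NodeKnitRecord5 (b16_main_of_rOperation_of_uvSlot)

/-! ## §1 GENERIC CORE FORM, LEVEL 0 KEPT, GUARD CARRIED, NO THEOREM 1 -/

section Generic

variable {F : T4Family} {G : Type} [GaugeGroup G] [MeasurableSpace G] [HaarData G] (M : RGMachineCore F G)

open Classical in
/-- **★ GENERIC CORE FORM, LEVEL 0 KEPT, GUARD CARRIED, THEOREM-1-FREE**: for a core `M` with `χ ≤ 1`, `0 ≤ A^η`, a density family `ρ` and ANY guard `Gd p k`: if on the window `]0, γ]` the
two-sided bound (2.50) (`em`, `ep`) holds at level `0` at EVERY field whenever `Gd p 0`, and at each level `k+1 ≤ K` for `dV`-almost every field whenever `Gd p (k+1)`, then there is a density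
family `ρ′` with `ρ′ p 0 = ρ p 0` (every run), `ρ′ p k =ᵐ[dV] ρ p k` (every run and level), and the GUARDED bound «window ⇒ `k ≤ K` ⇒ `Gd p k` ⇒ ∀ V, (2.50) at the updated construction with
`em`, `max ep (−em)`».  Re-choice: the upper barrier `exp(max (ep g_k) (−em g_k)·|T₁^{(k)}|)` on the GUARDED exceptional sets (empty at level 0, null at levels ≥ 1), `ρ` elsewhere.
[cite: Balaban1989LargeFieldII, (0.1) pp.355–356; Balaban1988Convergent, Cor. 3 (2.50) p.264 (bookkeeping)] -/
theorem exists_rho_keep0_ae_eq_guardedUV_construction_of_ae (ρ : (p : B12.RunParams) → (k : ℕ) → Density (F.P p.K) k G) (Gd : B12.RunParams → ℕ → Prop)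
    (hχ : ∀ p k V, M.χ p k V ≤ 1) (hA : ∀ p k V, 0 ≤ M.wilsonBG p k V) {γ : ℝ} {em ep : ℝ → ℝ}
    (h0 : ∀ p : B12.RunParams, (M.construction ρ p).flow.InInterval γ p.K → Gd p 0 → ∀ V,
      B16.UVIneq (M.construction ρ p) 0 V (em ((M.construction ρ p).flow.g 0)) (ep ((M.construction ρ p).flow.g 0)))
    (hae : ∀ p : B12.RunParams, (M.construction ρ p).flow.InInterval γ p.K → ∀ k, k + 1 ≤ p.K → Gd p (k + 1) →
      ∀ᵐ V ∂(fieldMeasure (F.P p.K) (k + 1) G), B16.UVIneq (M.construction ρ p) (k + 1) V (em ((M.construction ρ p).flow.g (k + 1))) (ep ((M.construction ρ p).flow.g (k + 1)))) :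
    ∃ ρ' : (p : B12.RunParams) → (k : ℕ) → Density (F.P p.K) k G,
      (∀ p, ρ' p 0 = ρ p 0) ∧ (∀ p k, ρ' p k =ᵐ[fieldMeasure (F.P p.K) k G] ρ p k) ∧
        ∀ p : B12.RunParams, (M.construction ρ p).flow.InInterval γ p.K → ∀ k, k ≤ p.K → Gd p k → ∀ V,
          B16.UVIneq ({ M.construction ρ p with ρ := ρ' p } : B16.RunData) k V (em ((M.construction ρ p).flow.g k))
            (max (ep ((M.construction ρ p).flow.g k)) (-(em ((M.construction ρ p).flow.g k)))) := by
  -- the GUARDED exceptional sets: inside the window, at guarded levels, where (2.50) fails (empty at level 0 by `h0`, null at levels ≥ 1 by `hae`)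
  let E : (p : B12.RunParams) → (k : ℕ) → Set (GaugeField (F.P p.K) k G) := fun p k =>
    {V | (M.construction ρ p).flow.InInterval γ p.K ∧ k ≤ p.K ∧ Gd p k ∧
      ¬ B16.UVIneq (M.construction ρ p) k V (em ((M.construction ρ p).flow.g k)) (ep ((M.construction ρ p).flow.g k))}
  have hE0 : ∀ p, E p 0 = ∅ := fun p => Set.eq_empty_iff_forall_notMem.mpr fun V hV => hV.2.2.2 (h0 p hV.1 hV.2.2.1 V)
  have hnull : ∀ p k, fieldMeasure (F.P p.K) k G (E p k) = 0 := by
    intro p k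
    cases k with
    | zero => rw [hE0 p, measure_empty]
    | succ k =>
      by_cases hP : (M.construction ρ p).flow.InInterval γ p.K ∧ k + 1 ≤ p.K ∧ Gd p (k + 1)
      · have hae' := hae p hP.1 k hP.2.1 hP.2.2
        rw [Filter.Eventually, mem_ae_iff] at hae'
        exact measure_mono_null (fun V hV => hV.2.2.2) hae'
      · have hE : E p (k + 1) = ∅ := Set.eq_empty_iff_forall_notMem.mpr fun V hV => hP ⟨hV.1, hV.2.1, hV.2.2.1⟩
        rw [hE, measure_empty]
  refine ⟨fun p k V => if V ∈ E p k then Real.exp (max (ep ((M.construction ρ p).flow.g k)) (-(em ((M.construction ρ p).flow.g k))) * ((M.construction ρ p).numSites k : ℝ)) else ρ p k V,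
    fun p => funext fun V => if_neg (by rw [hE0 p]; exact Set.notMem_empty V), fun p k => ?_, fun p hP k hk hG V => ?_⟩
  · filter_upwards [measure_eq_zero_iff_ae_notMem.1 (hnull p k)] with V hV
    exact if_neg hV
  · by_cases hV : V ∈ E p k
    · refine ⟨?_, ?_⟩
      · show (M.construction ρ p).χ k V * Real.exp (-(1 / ((M.construction ρ p).flow.g k) ^ 2 * (M.construction ρ p).wilsonBG k V) - em ((M.construction ρ p).flow.g k) * ((M.construction ρ p).numSites k : ℝ)) ≤
          (if V ∈ E p k then Real.exp (max (ep ((M.construction ρ p).flow.g k)) (-(em ((M.construction ρ p).flow.g k))) * ((M.construction ρ p).numSites k : ℝ)) else ρ p k V)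
        rw [if_pos hV]
        exact uvIneq_barrier_le (hχ p k V) (mul_nonneg (by positivity) (hA p k V)) (Nat.cast_nonneg _)
      · show (if V ∈ E p k then Real.exp (max (ep ((M.construction ρ p).flow.g k)) (-(em ((M.construction ρ p).flow.g k))) * ((M.construction ρ p).numSites k : ℝ)) else ρ p k V) ≤
          Real.exp (max (ep ((M.construction ρ p).flow.g k)) (-(em ((M.construction ρ p).flow.g k))) * ((M.construction ρ p).numSites k : ℝ))
        rw [if_pos hV]
    · have huv : B16.UVIneq (M.construction ρ p) k V (em ((M.construction ρ p).flow.g k)) (ep ((M.construction ρ p).flow.g k)) := by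
        by_contra hc
        exact hV ⟨hP, hk, hG, hc⟩
      have h := uvIneq_mono_ep (M.construction ρ p) k V (le_max_left (ep ((M.construction ρ p).flow.g k)) (-(em ((M.construction ρ p).flow.g k)))) huv
      refine ⟨?_, ?_⟩
      · show _ ≤ (if V ∈ E p k then _ else ρ p k V)
        rw [if_neg hV]
        exact h.1
      · show (if V ∈ E p k then _ else ρ p k V) ≤ _
        rw [if_neg hV]
        exact h.2

end Generic

/-! ## §2 AT NODE 00's χ-GENERIC ∕ RE-CENTRED STAGE-13 RECORD: the engines' N13 row ⟹ a REVISION carrying the `SLaw`-guarded pointwise row -/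

section RecordChi

variable (F : T4Family) (N : ℕ) [NeZero N] (θ : Stage13HParams F N) (χ : ChiSlot F N) (h : θ.Provisos₁₃SepCoPHChi F N χ)

/-- **★★ THE ENGINES' N13 ROW ⟹ A REVISION WITH THE GUARDED POINTWISE ROW, χ-GENERIC, THEOREM-1-FREE.**  At the χ-generic record (`hχ1 : χ ≤ 1`): the row with «every `U`» at level 0 and
«`dV`-a.e. `U`» at levels `k+1 ≤ K`, each under its `SLaw₁₃CoPHChi` guard, on the window `γ` ⟹ `∃ v : Revision₁₃Chi F N θ χ h` such that at every windowed run, every `k ≤ K` with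
`SLaw₁₃CoPHChi θ χ P k` and EVERY field `U`: `χ_k(U)·exp[−A^η_k(U)∕g_k² − em(g_k)·|T₁^{(k)}|] ≤ v.ρ P k U ≤ exp[max (ep g_k) (−em g_k)·|T₁^{(k)}|]` (§1 at the χ-generic core
`coreOfRecord₁₃CoPHChi θ χ`, `(datum).C = construction densOfRecord₁₃Chi`, `rfl`; the revised datum's construction is the `ρ`-update, `rfl`).  HYPOTHESIS-shaped row; N13 NOT discharged.
[cite: Balaban1989LargeFieldII, (0.1) pp.355–356; Balaban1988Convergent, (2.18) p.257, Cor. 3 (2.50) p.264 (bookkeeping)] -/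
theorem exists_revision₁₃Chi_guardedUVRowV_of_row0_of_aeRowSucc
    (hχ1 : ∀ (K : ℕ) (g : ℕ → ℝ) (k : ℕ) (V : GaugeField (F.P K) k (SU N)), χ K g k V ≤ 1) {γ : ℝ} {em ep : ℝ → ℝ}
    (hrow0 : ∀ P : B12.RunParams, ((datumOfRecord₁₃SepCoPHChi F N θ χ h).C P).flow.InInterval γ P.K → SLaw₁₃CoPHChi F N θ χ P 0 →
      ∀ U : GaugeField (F.P P.K) 0 (SU N),
        χ P.K (gOfRecord₁₃Chi F N θ.toStage13Params χ P) 0 U *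
              Real.exp (-(1 / (gOfRecord₁₃Chi F N θ.toStage13Params χ P 0) ^ 2 * wilsonBGOfRecord F N θ.εbg P 0 U)
                - em (gOfRecord₁₃Chi F N θ.toStage13Params χ P 0) * (Fintype.card (Site (F.P P.K) 0) : ℝ)) ≤ densOfRecord₁₃Chi F N θ.toStage13Params χ P 0 U ∧
          densOfRecord₁₃Chi F N θ.toStage13Params χ P 0 U ≤ Real.exp (ep (gOfRecord₁₃Chi F N θ.toStage13Params χ P 0) * (Fintype.card (Site (F.P P.K) 0) : ℝ)))
    (hrow : ∀ P : B12.RunParams, ((datumOfRecord₁₃SepCoPHChi F N θ χ h).C P).flow.InInterval γ P.K → ∀ k, k + 1 ≤ P.K → SLaw₁₃CoPHChi F N θ χ P (k + 1) →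
      ∀ᵐ U ∂(fieldMeasure (F.P P.K) (k + 1) (SU N)),
        χ P.K (gOfRecord₁₃Chi F N θ.toStage13Params χ P) (k + 1) U *
              Real.exp (-(1 / (gOfRecord₁₃Chi F N θ.toStage13Params χ P (k + 1)) ^ 2 * wilsonBGOfRecord F N θ.εbg P (k + 1) U)
                - em (gOfRecord₁₃Chi F N θ.toStage13Params χ P (k + 1)) * (Fintype.card (Site (F.P P.K) (k + 1)) : ℝ)) ≤ densOfRecord₁₃Chi F N θ.toStage13Params χ P (k + 1) U ∧
          densOfRecord₁₃Chi F N θ.toStage13Params χ P (k + 1) U ≤ Real.exp (ep (gOfRecord₁₃Chi F N θ.toStage13Params χ P (k + 1)) * (Fintype.card (Site (F.P P.K) (k + 1)) : ℝ))) :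
    ∃ v : Revision₁₃Chi F N θ χ h, ∀ P : B12.RunParams, ((datumOfRecord₁₃SepCoPHVChi F N θ χ h v).C P).flow.InInterval γ P.K → ∀ k, k ≤ P.K → SLaw₁₃CoPHChi F N θ χ P k →
      ∀ U : GaugeField (F.P P.K) k (SU N),
        χ P.K (gOfRecord₁₃Chi F N θ.toStage13Params χ P) k U *
              Real.exp (-(1 / (gOfRecord₁₃Chi F N θ.toStage13Params χ P k) ^ 2 * wilsonBGOfRecord F N θ.εbg P k U)
                - em (gOfRecord₁₃Chi F N θ.toStage13Params χ P k) * (Fintype.card (Site (F.P P.K) k) : ℝ)) ≤ v.ρ P k U ∧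
          v.ρ P k U ≤ Real.exp (max (ep (gOfRecord₁₃Chi F N θ.toStage13Params χ P k)) (-(em (gOfRecord₁₃Chi F N θ.toStage13Params χ P k))) * (Fintype.card (Site (F.P P.K) k) : ℝ)) := by
  obtain ⟨ρ', h0, hae, hG⟩ := exists_rho_keep0_ae_eq_guardedUV_construction_of_ae (coreOfRecord₁₃CoPHChi F N θ χ) (densOfRecord₁₃Chi F N θ.toStage13Params χ)
    (fun P k => SLaw₁₃CoPHChi F N θ χ P k) (fun P k V => (signs_datum_chi F N θ χ h hχ1 P k V).1) (fun P k V => (signs_datum_chi F N θ χ h hχ1 P k V).2) (γ := γ) (em := em) (ep := ep)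
    (fun P hP hG V => (uvIneq_at_record₁₃SepCoPH_iff_chi F N θ χ h P 0 V _ _).mpr (hrow0 P hP hG V))
    (fun P hP k hk hG => by
      filter_upwards [hrow P hP k hk hG] with U hU
      exact (uvIneq_at_record₁₃SepCoPH_iff_chi F N θ χ h P (k + 1) U _ _).mpr hU)
  exact ⟨⟨ρ', h0, fun P k _ => hae P (k + 1)⟩, fun P hP k hk hGd U => hG P hP k hk hGd U⟩

end RecordChi

section RecordAx

variable (F : T4Family) (N : ℕ) [NeZero N] (θ : Stage13HParams F N) (h : θ.Provisos₁₃SepCoPHAx F N)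

/-- **★★★ THE K1ᴬ ENGINE's N13 BINDER ⟹ RUNG 1ⱽᵂ's N13 BILL (guarded currency), THEOREM-1-FREE, RE-CENTRED RECORD**: the engines' row `h13` at `datumOfRecord₁₃SepCoPHAx θ h` VERBATIM
(✓p811182 §2 ∕ ✓p810415 §2Ax: window `γ₁₃`, guard `SLaw₁₃CoPHChi θ χ⋆`, `em`∕`ep` of `g_k`, level 0 at every `U`, levels ≥ 1 `dV`-a.e.; `χ⋆ := chiβOfRecord₁₃Ax θ ≤ 1` by (G)) ⟹
`∃ v : Revision₁₃Ax F N θ h`, the `SLaw`-GUARDED pointwise (2.50) on `v.ρ` with `em`, `max ep (−em)` on the window — the hypothesis of §3 ∕ of the -a hand's guarded rung-1ⱽᵂ assembler.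
N13 NOT discharged; the row is a HYPOTHESIS. [cite: Balaban1989LargeFieldII, (0.1) pp.355–356; Balaban1988Convergent, (2.18) p.257, Cor. 3 (2.50) p.264; Balaban1987RG1, (2.9) p.266 with (2.3) p.265 (bookkeeping)] -/
theorem exists_revision₁₃Ax_guardedUVRowV_of_row0_of_aeRowSucc {γ : ℝ} {em ep : ℝ → ℝ}
    (hrow0 : ∀ P : B12.RunParams, ((datumOfRecord₁₃SepCoPHAx F N θ h).C P).flow.InInterval γ P.K →
      SLaw₁₃CoPHChi F N θ (chiβOfRecord₁₃Ax F N θ.toStage13Params) P 0 →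
      ∀ U : GaugeField (F.P P.K) 0 (SU N),
        chiβOfRecord₁₃Ax F N θ.toStage13Params P.K (gOfRecord₁₃Ax F N θ.toStage13Params P) 0 U *
              Real.exp (-(1 / (gOfRecord₁₃Ax F N θ.toStage13Params P 0) ^ 2 * wilsonBGOfRecord F N θ.εbg P 0 U)
                - em (gOfRecord₁₃Ax F N θ.toStage13Params P 0) * (Fintype.card (Site (F.P P.K) 0) : ℝ)) ≤
            densOfRecord₁₃Chi F N θ.toStage13Params (chiβOfRecord₁₃Ax F N θ.toStage13Params) P 0 U ∧
          densOfRecord₁₃Chi F N θ.toStage13Params (chiβOfRecord₁₃Ax F N θ.toStage13Params) P 0 U ≤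
            Real.exp (ep (gOfRecord₁₃Ax F N θ.toStage13Params P 0) * (Fintype.card (Site (F.P P.K) 0) : ℝ)))
    (hrow : ∀ P : B12.RunParams, ((datumOfRecord₁₃SepCoPHAx F N θ h).C P).flow.InInterval γ P.K → ∀ k, k + 1 ≤ P.K →
      SLaw₁₃CoPHChi F N θ (chiβOfRecord₁₃Ax F N θ.toStage13Params) P (k + 1) →
      ∀ᵐ U ∂(fieldMeasure (F.P P.K) (k + 1) (SU N)),
        chiβOfRecord₁₃Ax F N θ.toStage13Params P.K (gOfRecord₁₃Ax F N θ.toStage13Params P) (k + 1) U *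
              Real.exp (-(1 / (gOfRecord₁₃Ax F N θ.toStage13Params P (k + 1)) ^ 2 * wilsonBGOfRecord F N θ.εbg P (k + 1) U)
                - em (gOfRecord₁₃Ax F N θ.toStage13Params P (k + 1)) * (Fintype.card (Site (F.P P.K) (k + 1)) : ℝ)) ≤
            densOfRecord₁₃Chi F N θ.toStage13Params (chiβOfRecord₁₃Ax F N θ.toStage13Params) P (k + 1) U ∧
          densOfRecord₁₃Chi F N θ.toStage13Params (chiβOfRecord₁₃Ax F N θ.toStage13Params) P (k + 1) U ≤
            Real.exp (ep (gOfRecord₁₃Ax F N θ.toStage13Params P (k + 1)) * (Fintype.card (Site (F.P P.K) (k + 1)) : ℝ))) :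
    ∃ v : Revision₁₃Ax F N θ h, ∀ P : B12.RunParams, ((datumOfRecord₁₃SepCoPHVAx F N θ h v).C P).flow.InInterval γ P.K → ∀ k, k ≤ P.K →
      SLaw₁₃CoPHChi F N θ (chiβOfRecord₁₃Ax F N θ.toStage13Params) P k → ∀ U : GaugeField (F.P P.K) k (SU N),
        chiβOfRecord₁₃Ax F N θ.toStage13Params P.K (gOfRecord₁₃Ax F N θ.toStage13Params P) k U *
              Real.exp (-(1 / (gOfRecord₁₃Ax F N θ.toStage13Params P k) ^ 2 * wilsonBGOfRecord F N θ.εbg P k U)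
                - em (gOfRecord₁₃Ax F N θ.toStage13Params P k) * (Fintype.card (Site (F.P P.K) k) : ℝ)) ≤ v.ρ P k U ∧
          v.ρ P k U ≤ Real.exp (max (ep (gOfRecord₁₃Ax F N θ.toStage13Params P k)) (-(em (gOfRecord₁₃Ax F N θ.toStage13Params P k))) * (Fintype.card (Site (F.P P.K) k) : ℝ)) :=
  exists_revision₁₃Chi_guardedUVRowV_of_row0_of_aeRowSucc F N θ (chiβOfRecord₁₃Ax F N θ.toStage13Params) h (chiβOfRecord₁₃Ax_le_one F N θ) hrow0 hrow

/-! ## §3 ★★ N13's NODE at a world bound to the REVISED re-centred datum from the GUARDED row (binding-agnostic) -/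

/-- **★★ N13 AT A REVISED RE-CENTRED-RECORD WORLD FROM THE `SLaw`-GUARDED POINTWISE ROW ON `v.ρ`** (Ax ∕ binding-agnostic twin of dag-n13-w3's `b16_main_at_recordV₁₃_of_uvRowV`): for
`w.C = (datumOfRecord₁₃SepCoPHVAx F N θ h v).C`, the 𝐑-operation leaf of `w.up P` (whatever the binding), `w.γ ≤ γ₁₃` and the guarded row with the world's letters `w.em ∕ w.ep` ⟹
`Dag.B16_main (leavesP w P)` — n13-a's `uvSlot_at_construction` at the χ-generic core `coreOfRecord₁₃CoPHChi θ χ⋆`, `ρ := v.ρ`, trivial representation, `Laws k _ := SLaw₁₃CoPHChi θ χ⋆ P k`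
(`sect2Form_coreOfRecord₁₃CoPH_iff_chi`), `datumOfRecord₁₃SepCoPHV_C_chi` (`rfl`).  HYPOTHESES displayed; N13 NOT discharged.
[cite: Balaban1989LargeFieldII, Thm 1 p.355, (0.1) pp.355–356, p.387, p.391; Balaban1988Convergent, (2.18) p.257, Cor. 3 (2.50) p.264; Balaban1989LargeFieldI, (0.2)–(0.4) p.176 (bookkeeping)] -/
theorem b16_main_at_recordVAx_of_rOperation_of_guardedUVRowV (v : Revision₁₃Ax F N θ h) (w : WorldP) (P : B12.RunParams)
    (hC : w.C = (datumOfRecord₁₃SepCoPHVAx F N θ h v).C) (hR : (w.up P).rOperation) {γ₁₃ : ℝ} (hγ : w.γ ≤ γ₁₃)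
    (hUVV : (genFlow (betaOfRecord₁₃Ax F N θ.toStage13Params) P.g0).InInterval γ₁₃ P.K → ∀ k, k ≤ P.K →
      SLaw₁₃CoPHChi F N θ (chiβOfRecord₁₃Ax F N θ.toStage13Params) P k → ∀ U : GaugeField (F.P P.K) k (SU N),
        chiβOfRecord₁₃Ax F N θ.toStage13Params P.K (gOfRecord₁₃Ax F N θ.toStage13Params P) k U *
              Real.exp (-(1 / (gOfRecord₁₃Ax F N θ.toStage13Params P k) ^ 2 * wilsonBGOfRecord F N θ.εbg P k U)
                - w.em (gOfRecord₁₃Ax F N θ.toStage13Params P k) * (Fintype.card (Site (F.P P.K) k) : ℝ)) ≤ v.ρ P k U ∧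
          v.ρ P k U ≤ Real.exp (w.ep (gOfRecord₁₃Ax F N θ.toStage13Params P k) * (Fintype.card (Site (F.P P.K) k) : ℝ))) :
    Dag.B16_main (leavesP w P) :=
  b16_main_of_rOperation_of_uvSlot w P hR
    (uvSlot_at_construction F N (coreOfRecord₁₃CoPHChi F N θ (chiβOfRecord₁₃Ax F N θ.toStage13Params)) v.ρ w P (Rep := fun _ => Unit) (fun _ => ())
      (fun k _ => SLaw₁₃CoPHChi F N θ (chiβOfRecord₁₃Ax F N θ.toStage13Params) P k) (fun k _ => v.ρ P k)
      (hC.trans (datumOfRecord₁₃SepCoPHV_C_chi F N θ (chiβOfRecord₁₃Ax F N θ.toStage13Params) h v)) (fun _ => rfl)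
      (fun k _ hs => (sect2Form_coreOfRecord₁₃CoPH_iff_chi F N θ (chiβOfRecord₁₃Ax F N θ.toStage13Params) P k).1 hs) hγ hUVV)

end RecordAx

end Summit.QuantumFields.YangMills.BalabanUVNodes.N13GuardedUVRowAtRevisionOfAERowsAtRecord13Ax

end
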